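import Mathlib
import Summits.ValiantsHypothesis.ValiantsHypothesis.Theorems.SymmetroidDescartesDerivedPencilRolleWalkDefs

/-!
# Route SymmetroidDescartes — refutation of `DerivedPencilRolle` (stmt-ValiantsHypothesis-18500):
dominance — a unique min-cost walk with integer gap determines the sign and size of the path sum

Helper file of the line `staircase-refutation` (crux stmt-ValiantsHypothesis-18500): proves the
registered stub `stub_walkSign` of the refutation skeleton `not_DerivedPencilRolle`
(Cruxes/DerivedPencilRolle/Lines/staircase_refutation.lean).

Plan: (1) expansion `pathSum d η t g v = Σ_(f : Fin g.length → V) walkVal d η t g v (List.ofFn f)`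
by induction on `g` (`pathSum_eq_sum_walkVal`);
(2) `walkCost = ⊤ ⇒ walkVal … (η^(-lam)) = 0` and `walkCost = c ⇒ walkVal … (η^(-lam)) = walkSign · η^c`
(induction, zpow algebra: `walkSign_walkVal_of_cost_eq_top`, `walkSign_walkVal_of_cost_eq_coe`);
(3) split off the term of `wstar`, bound the other `≤ |V|^T` terms by `η^(c+1)` each.
-/

set_option linter.dupNamespace false


namespace Summit.ValiantsHypothesis.ValiantsHypothesis.Theorems.SymmetroidDescartes.DPR

open scoped BigOperators

/-! ### Helper lemmas for the dominance stub -/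

section walkSignHelpers

variable {V : Type*} {K : ℕ} (d : Fin K → ℕ)

/-- The sign of a walk is `1` or `-1`. [folklore] -/
theorem walkSign_eq_one_or_eq_neg_one :
    ∀ (g : List (WLayer V K)) (v : V) (w : List V), walkSign g v w = 1 ∨ walkSign g v w = -1
  | [], _, _ => by simp
  | _ :: _, _, [] => Or.inl rfl
  | l :: g, v, v' :: w => by
      have ih := walkSign_eq_one_or_eq_neg_one g v' w
      rw [walkSign_cons_cons]
      cases l v v' with
      | none => simpa using ih
      | some e =>
          simp only [WEdge.sgn]
          cases e.neg <;> rcases ih with h | h <;> simp [h]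

/-- The sign of a walk has absolute value `1` (as a real number). [folklore] -/
theorem walkSign_abs_cast (g : List (WLayer V K)) (v : V) (w : List V) :
    |((walkSign g v w : ℤ) : ℝ)| = 1 := by
  rcases walkSign_eq_one_or_eq_neg_one g v w with h | h <;> simp [h]

/-- One step at the point `t = η^(-lam)`: the value of an edge is its sign times `η^(step cost)`.
[folklore] -/
theorem walkSign_stepVal_some {η : ℝ} (hη : η ≠ 0) (lam : ℤ) (e : WEdge K) :
    stepVal d η (η ^ (-lam)) (some e) = (e.sgn : ℝ) * η ^ (e.a - lam * (d e.cls : ℤ)) := by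
  simp only [stepVal]
  rw [← zpow_natCast, ← zpow_mul, mul_assoc, ← zpow_add₀ hη,
    show e.a - lam * (d e.cls : ℤ) = e.a + -lam * (d e.cls : ℤ) by ring]

/-- A walk of cost `⊤` (a missing edge or a length mismatch) has value `0` at `t = η^(-lam)`.
[folklore] -/
theorem walkSign_walkVal_of_cost_eq_top (η : ℝ) (lam : ℤ) :
    ∀ (g : List (WLayer V K)) (v : V) (w : List V),
      walkCost d lam g v w = ⊤ → walkVal d η (η ^ (-lam)) g v w = 0
  | [], _, [], h => by simp at h
  | [], _, _ :: _, _ => rfl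
  | _ :: _, _, [], _ => rfl
  | l :: g, v, v' :: w, h => by
      rw [walkCost_cons_cons, WithTop.add_eq_top] at h
      rw [walkVal_cons_cons]
      cases hl : l v v' with
      | none => simp [stepVal]
      | some e =>
          rw [hl] at h
          have h' : walkCost d lam g v' w = ⊤ :=
            h.resolve_left (by simp only [stepCost]; exact WithTop.coe_ne_top)
          rw [walkSign_walkVal_of_cost_eq_top η lam g v' w h', mul_zero]

/-- A walk of finite cost `c` has value `walkSign · η^c` at `t = η^(-lam)`. [folklore] -/
theorem walkSign_walkVal_of_cost_eq_coe {η : ℝ} (hη : η ≠ 0) (lam : ℤ) :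
    ∀ (g : List (WLayer V K)) (v : V) (w : List V) (c : ℤ),
      walkCost d lam g v w = (c : WithTop ℤ) →
        walkVal d η (η ^ (-lam)) g v w = (walkSign g v w : ℝ) * η ^ c
  | [], _, [], c, h => by
      have hc : (0 : ℤ) = c := by rw [walkCost_nil_nil] at h; exact_mod_cast h
      subst hc
      simp
  | [], _, _ :: _, _, h => by simp at h
  | _ :: _, _, [], _, h => by simp at h
  | l :: g, v, v' :: w, c, h => by
      rw [walkCost_cons_cons] at h
      rw [walkVal_cons_cons, walkSign_cons_cons]
      cases hl : l v v' with
      | none => rw [hl] at h; simp [stepCost] at h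
      | some e =>
          rw [hl] at h
          simp only [stepCost] at h
          cases hw : walkCost d lam g v' w with
          | top => rw [hw] at h; simp at h
          | coe c' =>
              rw [hw, ← WithTop.coe_add, WithTop.coe_eq_coe] at h
              subst h
              rw [walkSign_walkVal_of_cost_eq_coe hη lam g v' w c' hw,
                walkSign_stepVal_some d hη lam e, zpow_add₀ hη]
              push_cast
              ring

end walkSignHelpers

/-- Expansion of the path sum (the summed product of the layer matrices) as the sum of the walk
values over all vertex sequences of the right length. [folklore] -/
theorem pathSum_eq_sum_walkVal {V : Type*} [Fintype V] [DecidableEq V] {K : ℕ} (d : Fin K → ℕ)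
    (η t : ℝ) : ∀ (g : List (WLayer V K)) (v : V),
      pathSum d η t g v = ∑ f : Fin g.length → V, walkVal d η t g v (List.ofFn f)
  | [], v => by simp [pathSum, Matrix.one_apply]
  | l :: g, v => by
      have ih : ∀ v' : V, pathSum d η t g v' = _ := fun v' => pathSum_eq_sum_walkVal d η t g v'
      simp only [pathSum, List.map_cons, List.prod_cons, Matrix.mul_apply] at ih ⊢
      rw [Finset.sum_comm]
      simp_rw [← Finset.mul_sum, ih, layerMat_apply]
      show _ = ∑ f : Fin (g.length + 1) → V, walkVal d η t (l :: g) v (List.ofFn f)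
      rw [← (Fin.consEquiv fun _ => V).sum_comp, Fintype.sum_prod_type]
      simp [List.ofFn_succ, Finset.mul_sum]


/-- dominance — a unique min-cost walk with integer gap determines the sign and size of the path sum [folklore] -/
theorem stub_walkSign : ∀ (V : Type) [Fintype V] [DecidableEq V] (K : ℕ) (d : Fin K → ℕ) (g : List (WLayer V K)) (v₀ : V) (lam : ℤ) (wstar : List V) (c : ℤ), walkCost d lam g v₀ wstar = (c : WithTop ℤ) → (∀ w : List V, w ≠ wstar → ((c + 1 : ℤ) : WithTop ℤ) ≤ walkCost d lam g v₀ w) → ∀ η : ℝ, 0 < η → η * (2 * (Fintype.card V : ℝ) ^ g.length) ≤ 1 → |pathSum d η (η ^ (-lam)) g v₀ - (walkSign g v₀ wstar : ℝ) * η ^ c| ≤ η ^ c / 2 := by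
  intro V _ _ K d g v₀ lam wstar c hcost hgap η hη hsmall
  have hη0 : η ≠ 0 := hη.ne'
  -- `η ≤ 1`, since `V` is nonempty
  have hcard : (1 : ℝ) ≤ (Fintype.card V : ℝ) :=
    Nat.one_le_cast.mpr (Fintype.card_pos_iff.mpr ⟨v₀⟩)
  have hη1 : η ≤ 1 := by
    have h1 : (1 : ℝ) ≤ 2 * (Fintype.card V : ℝ) ^ g.length := by
      have := one_le_pow₀ (n := g.length) hcard
      linarith
    calc η = η * 1 := (mul_one η).symm
      _ ≤ η * (2 * (Fintype.card V : ℝ) ^ g.length) := mul_le_mul_of_nonneg_left h1 hη.le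
      _ ≤ 1 := hsmall
  -- the minimal walk as a function `Fin g.length → V`
  have hlen : wstar.length = g.length :=
    length_eq_of_walkCost_ne_top d lam g v₀ wstar (by rw [hcost]; exact WithTop.coe_ne_top)
  obtain ⟨fstar, hfstar⟩ : ∃ f : Fin g.length → V, List.ofFn f = wstar :=
    ⟨fun i => wstar.get (Fin.cast hlen.symm i),
      ((List.ofFn_congr hlen _).symm.trans (List.ofFn_get wstar))⟩
  -- every other walk contributes at most `η^(c+1)` in absolute value
  have hother : ∀ f : Fin g.length → V, f ≠ fstar →
      |walkVal d η (η ^ (-lam)) g v₀ (List.ofFn f)| ≤ η ^ (c + 1) := by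
    intro f hf
    have hne : List.ofFn f ≠ wstar := fun h => hf (List.ofFn_injective (h.trans hfstar.symm))
    have hge := hgap _ hne
    cases hw : walkCost d lam g v₀ (List.ofFn f) with
    | top =>
        rw [walkSign_walkVal_of_cost_eq_top d η lam g v₀ _ hw, abs_zero]
        exact (zpow_pos hη _).le
    | coe c' =>
        rw [hw, WithTop.coe_le_coe] at hge
        rw [walkSign_walkVal_of_cost_eq_coe d hη0 lam g v₀ _ c' hw, abs_mul, walkSign_abs_cast,
          one_mul, abs_of_pos (zpow_pos hη _)]
        exact zpow_le_zpow_right_of_le_one₀ hη hη1 hge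
  -- split off the dominant term and bound the rest
  rw [pathSum_eq_sum_walkVal, ← Finset.add_sum_erase _ _ (Finset.mem_univ fstar), hfstar,
    walkSign_walkVal_of_cost_eq_coe d hη0 lam g v₀ wstar c hcost, add_sub_cancel_left]
  calc |∑ f ∈ Finset.univ.erase fstar, walkVal d η (η ^ (-lam)) g v₀ (List.ofFn f)|
      ≤ ∑ f ∈ Finset.univ.erase fstar, |walkVal d η (η ^ (-lam)) g v₀ (List.ofFn f)| :=
        Finset.abs_sum_le_sum_abs _ _
    _ ≤ ∑ f ∈ Finset.univ.erase fstar, η ^ (c + 1) :=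
        Finset.sum_le_sum fun f hf => hother f (Finset.ne_of_mem_erase hf)
    _ ≤ ∑ _f : Fin g.length → V, η ^ (c + 1) :=
        Finset.sum_le_sum_of_subset_of_nonneg (Finset.erase_subset _ _)
          (fun _ _ _ => (zpow_pos hη _).le)
    _ = (Fintype.card V : ℝ) ^ g.length * (η ^ c * η) := by
        rw [Finset.sum_const, Finset.card_univ, Fintype.card_fun, Fintype.card_fin, nsmul_eq_mul,
          zpow_add_one₀ hη0]
        push_cast
        ring
    _ = (η * (2 * (Fintype.card V : ℝ) ^ g.length)) * (η ^ c / 2) := by ring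
    _ ≤ 1 * (η ^ c / 2) := mul_le_mul_of_nonneg_right hsmall (by positivity)
    _ = η ^ c / 2 := one_mul _

end Summit.ValiantsHypothesis.ValiantsHypothesis.Theorems.SymmetroidDescartes.DPR
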